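import Literature.Barriers.QuantumAdvantage.LatticeRigidityGenerators
import Mathlib.Data.ZMod.Basic
import Mathlib.Logic.Equiv.Fintype
import HarnessLib

/-!
# Lattice rigidity of the Toffoli+Hadamard gate group — exact synthesis over `ℤ[1/2]`

Support file for the discharge of `latticeRigidity_finiteImage` (`LatticeRigidity.lean`):
Amy–Glaudell–Ross' exact-synthesis theorem for the ring `𝔻 = ℤ[1/2]`
[cite: AmyGlaudellRoss2020, §5.1, Lemmas 5.1–5.4 and Theorem 5.5]: the group
`Γ_N = O_N(ℤ[1/2])` (`dyadicOrthogonalGroup N`, `N ≥ 4`) is generated by the one-level sign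
changes `(−1)_[a]` (`negAt`), the two-level permutations `X_[a,b]` (here: all permutation matrices
`permOp σ`) and the four-level blocks `(H⊗H)_[a,b,c,d]` (here: the single block `hadamardBlock`
on the coordinates `0,1,2,3`; the others are its conjugates by permutation matrices):
`closure_agrGenerators_eq_top`.

The proof follows the paper: a unit vector `v = z / 2^k` over `𝔻` (`z` integral, `∑ z² = 4^k`)
with `k > 0` has a number of odd entries divisible by `4` (squares mod `4`, Lemma 5.3); after sign
changes making four odd entries `≡ 1 (mod 4)`, the block `H⊗H` on them produces even entries
(Lemma 5.2), so the least denominator exponent drops (Lemma 5.3); at `k = 0` the vector is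
`± e_j` and a signed transposition finishes (Lemma 5.4, column lemma); reducing the columns of a
matrix one at a time inside the stabiliser of the columns already reduced gives Theorem 5.5.
The only deviation from the printed argument is bookkeeping: the sign fixes of Lemma 5.2 are
performed one at a time, the induction being on `#{odd entries} + #{entries ≡ 3 (mod 4)}`.

## Contents

* `agrGenerators hN` — the generating set; `stabLow N m` — the stabiliser of `e_0,…,e_{m-1}`.
* `four_dvd_card_filter_odd` (Lemma 5.3, counting), `four_dvd_sum_hhSignZ_mul` (Lemma 5.2),
  `blockStep`, `conj_hadamardBlock_mulVec` (action of a conjugated block on `z / 2^k`).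
* `exists_reduce_lde` (Lemma 5.3), `exists_mem_mulVec_eq_single` (Lemma 5.4),
  `closure_agrGenerators_eq_top` (Theorem 5.5).
-/

noncomputable section

open Matrix Equiv

namespace Literature.Barriers.QuantumAdvantage

/-! ## Exact synthesis: `Γ_N` is generated by sign changes, permutations and one `H ⊗ H` block -/

section Synthesis

variable {N : ℕ}

/-- The Amy–Glaudell–Ross generating set of `Γ_N = O_N(ℤ[1/2])`: the one-level sign changes, the
permutation matrices, and the four-level block `(H⊗H)_[0,1,2,3]`.
[cite: AmyGlaudellRoss2020, §5.1, eq. (generators)] -/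
def agrGenerators (hN : 4 ≤ N) : Set (dyadicOrthogonalGroup N) :=
  Set.range negAt ∪ Set.range permOp ∪ {hadamardBlock hN}

/-- Sign changes are generators. [cite: AmyGlaudellRoss2020, §5.1] -/
theorem negAt_mem_closure (hN : 4 ≤ N) (i : Fin N) :
    negAt i ∈ Subgroup.closure (agrGenerators hN) :=
  Subgroup.subset_closure (Or.inl (Or.inl ⟨i, rfl⟩))

/-- Permutation matrices are generators. [cite: AmyGlaudellRoss2020, §5.1] -/
theorem permOp_mem_closure (hN : 4 ≤ N) (σ : Equiv.Perm (Fin N)) :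
    permOp σ ∈ Subgroup.closure (agrGenerators hN) :=
  Subgroup.subset_closure (Or.inl (Or.inr ⟨σ, rfl⟩))

/-- The block is a generator. [cite: AmyGlaudellRoss2020, §5.1] -/
theorem hadamardBlock_mem_closure (hN : 4 ≤ N) :
    hadamardBlock hN ∈ Subgroup.closure (agrGenerators hN) :=
  Subgroup.subset_closure (Or.inr rfl)

/-- The stabiliser in `Γ_N` of the first `m` standard basis vectors `e_0, …, e_{m-1}`.
[cite: AmyGlaudellRoss2020, Theorem 5.5 (the columns already reduced)] -/
def stabLow (N m : ℕ) : Subgroup (dyadicOrthogonalGroup N) where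
  carrier := {g | ∀ j : Fin N, j.val < m → toMat N g *ᵥ Pi.single j 1 = Pi.single j 1}
  mul_mem' := by
    intro g h hg hh j hj
    simp only [Set.mem_setOf_eq] at hg hh ⊢
    rw [toMat_mul_mulVec, hh j hj, hg j hj]
  one_mem' := by
    intro j _
    rw [map_one, Matrix.one_mulVec]
  inv_mem' := by
    intro g hg j hj
    simp only [Set.mem_setOf_eq] at hg ⊢
    conv_lhs => rw [← hg j hj]
    rw [toMat_inv_mulVec_mulVec]

/-- Membership in `stabLow`. [cite: AmyGlaudellRoss2020, Theorem 5.5] -/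
theorem mem_stabLow_iff {m : ℕ} {g : dyadicOrthogonalGroup N} :
    g ∈ stabLow N m ↔ ∀ j : Fin N, j.val < m → toMat N g *ᵥ Pi.single j 1 = Pi.single j 1 :=
  Iff.rfl

/-- A sign change at a coordinate `≥ m` fixes `e_0, …, e_{m-1}`. [cite: AmyGlaudellRoss2020, Lemma 5.4] -/
theorem negAt_mem_stabLow {m : ℕ} {i : Fin N} (hi : m ≤ i.val) : negAt i ∈ stabLow N m := by
  intro j hj
  funext l
  rw [negAt_mulVec]
  split_ifs with h
  · subst h
    have : l ≠ j := fun h => by subst h; omega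
    simp [this]
  · rfl

/-- A permutation fixing the coordinates `< m` fixes `e_0, …, e_{m-1}`.
[cite: AmyGlaudellRoss2020, Lemma 5.4] -/
theorem permOp_mem_stabLow {m : ℕ} {σ : Equiv.Perm (Fin N)} (hσ : ∀ j : Fin N, j.val < m → σ j = j) :
    permOp σ ∈ stabLow N m := by
  intro j hj
  rw [permOp_mulVec_single, hσ j hj]

/-- A conjugate `P_σ (H⊗H)_[0,1,2,3] P_σ⁻¹ = (H⊗H)_[σ0,σ1,σ2,σ3]` of the block whose four
coordinates are all `≥ m` fixes `e_0, …, e_{m-1}`. [cite: AmyGlaudellRoss2020, Lemma 5.3] -/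
theorem conj_hadamardBlock_mem_stabLow (hN : 4 ≤ N) {m : ℕ} {σ : Equiv.Perm (Fin N)}
    (hσ : ∀ q : Fin 4, m ≤ (σ (Fin.castLE hN q)).val) :
    permOp σ * hadamardBlock hN * permOp σ⁻¹ ∈ stabLow N m := by
  intro j hj
  have hj4 : ¬ (σ.symm j).val < 4 := fun h => by
    have h1 := hσ ⟨(σ.symm j).val, h⟩
    have h2 : Fin.castLE hN ⟨(σ.symm j).val, h⟩ = σ.symm j := Fin.ext rfl
    rw [h2, Equiv.apply_symm_apply] at h1
    omega
  rw [toMat_mul_mulVec, toMat_mul_mulVec, permOp_mulVec_single,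
    show σ⁻¹ j = σ.symm j from rfl, hadamardBlock_mulVec_single hN hj4, permOp_mulVec_single,
    Equiv.apply_symm_apply]

/-! ### Arithmetic of dyadic unit vectors -/

/-- A vector with dyadic entries is `z / 2^k` for an integer vector `z`.
[cite: AmyGlaudellRoss2020, §5.1, eq. (V = W / 2^q)] -/
theorem exists_eq_intCast_div_two_pow (u : Fin N → ℚ) (hu : ∀ i, u i ∈ dyadicRationals) :
    ∃ (k : ℕ) (z : Fin N → ℤ), u = fun i => (z i : ℚ) / 2 ^ k := by
  choose a k hk using fun i => (mem_dyadicRationals_iff.1 (hu i))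
  refine ⟨∑ i, k i, fun i => a i * 2 ^ (∑ i, k i - k i), funext fun i => ?_⟩
  have hle : k i ≤ ∑ i, k i := Finset.single_le_sum (fun j _ => Nat.zero_le (k j)) (Finset.mem_univ i)
  have h2 : (2 : ℚ) ^ (∑ i, k i) = 2 ^ k i * 2 ^ (∑ i, k i - k i) := by
    rw [← pow_add, Nat.add_sub_cancel' hle]
  rw [hk i, h2, Int.cast_mul, Int.cast_pow, Int.cast_ofNat,
    mul_div_mul_right _ _ (pow_ne_zero _ two_ne_zero)]

/-- Squares modulo `4` detect parity. [cite: AmyGlaudellRoss2020, Lemma 5.1 (proof)] -/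
theorem intCast_sq_zmod_four (x : ℤ) : ((x : ZMod 4)) ^ 2 = if Odd x then 1 else 0 := by
  rcases Int.even_or_odd x with ⟨t, rfl⟩ | ⟨t, rfl⟩
  · rw [if_neg (Int.not_odd_iff_even.2 ⟨t, rfl⟩)]
    have : ((t + t : ℤ) : ZMod 4) ^ 2 = ((t ^ 2 : ℤ) : ZMod 4) * 4 := by push_cast; ring
    rw [this, show (4 : ZMod 4) = 0 from rfl, mul_zero]
  · rw [if_pos ⟨t, rfl⟩]
    have : ((2 * t + 1 : ℤ) : ZMod 4) ^ 2 = ((t ^ 2 + t : ℤ) : ZMod 4) * 4 + 1 := by push_cast; ring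
    rw [this, show (4 : ZMod 4) = 0 from rfl, mul_zero, zero_add]

/-- **Amy–Glaudell–Ross, Lemma 5.3 (counting).** If `∑ z_i² = 4^(k+1)` then the number of odd
`z_i` is divisible by `4`. [cite: AmyGlaudellRoss2020, Lemma 5.3] -/
theorem four_dvd_card_filter_odd {k : ℕ} {z : Fin N → ℤ} (hz : ∑ i, z i ^ 2 = 4 ^ (k + 1)) :
    4 ∣ (Finset.univ.filter fun i => Odd (z i)).card := by
  have h := congrArg (fun x : ℤ => (x : ZMod 4)) hz
  simp only [Int.cast_sum, Int.cast_pow, intCast_sq_zmod_four, Finset.sum_boole, Int.cast_ofNat]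
    at h
  rw [pow_succ, show (4 : ZMod 4) = 0 from rfl, mul_zero] at h
  exact (ZMod.natCast_eq_zero_iff _ _).1 h

/-- An integer vector of squared norm `1` is `± e_{i₀}`. [cite: AmyGlaudellRoss2020, Lemma 5.4 (case lde = 0)] -/
theorem exists_eq_single_of_sum_sq_eq_one {z : Fin N → ℤ} (hz : ∑ i, z i ^ 2 = 1) :
    ∃ i₀ : Fin N, (z i₀ = 1 ∨ z i₀ = -1) ∧ ∀ i, i ≠ i₀ → z i = 0 := by
  obtain ⟨i₀, hi₀⟩ : ∃ i₀, z i₀ ≠ 0 := by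
    by_contra! h
    simp [h] at hz
  have hsplit := Finset.add_sum_erase Finset.univ (fun i => z i ^ 2) (Finset.mem_univ i₀)
  rw [hz] at hsplit
  have h1 : 1 ≤ z i₀ ^ 2 := by
    have := sq_nonneg (z i₀)
    have : z i₀ ^ 2 ≠ 0 := pow_ne_zero 2 hi₀
    omega
  have hrest : 0 ≤ ∑ i ∈ Finset.univ.erase i₀, z i ^ 2 := Finset.sum_nonneg fun i _ => sq_nonneg _
  have hsq : z i₀ ^ 2 = 1 := by omega
  have hzero : ∑ i ∈ Finset.univ.erase i₀, z i ^ 2 = 0 := by omega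
  rw [Finset.sum_eq_zero_iff_of_nonneg fun i _ => sq_nonneg (z i)] at hzero
  refine ⟨i₀, sq_eq_one_iff.1 hsq, fun i hi => ?_⟩
  exact pow_eq_zero_iff (n := 2) (by norm_num) |>.1 (hzero i (Finset.mem_erase.2 ⟨hi, Finset.mem_univ i⟩))

/-- Norm bookkeeping: if `g ∈ Γ_N` maps `z / 2^k` to `z' / 2^k'` then `∑ z'² · 4^k = ∑ z² · 4^k'`.
[cite: AmyGlaudellRoss2020, Lemma 5.3] -/
theorem sum_sq_mul_eq_of_mulVec_eq (g : dyadicOrthogonalGroup N) {z z' : Fin N → ℤ} {k k' : ℕ}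
    (h : toMat N g *ᵥ (fun i => (z i : ℚ) / 2 ^ k) = fun i => (z' i : ℚ) / 2 ^ k') :
    (∑ i, z' i ^ 2) * 4 ^ k = (∑ i, z i ^ 2) * 4 ^ k' := by
  have hd := dotProduct_toMat_mulVec g (fun i => (z i : ℚ) / 2 ^ k) (fun i => (z i : ℚ) / 2 ^ k)
  rw [h] at hd
  simp only [dotProduct, div_mul_div_comm, ← Finset.sum_div] at hd
  rw [div_eq_div_iff (mul_ne_zero (pow_ne_zero _ two_ne_zero) (pow_ne_zero _ two_ne_zero))
    (mul_ne_zero (pow_ne_zero _ two_ne_zero) (pow_ne_zero _ two_ne_zero))] at hd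
  have e : ∀ n : ℕ, (2 : ℚ) ^ n * 2 ^ n = 4 ^ n := fun n => by rw [← mul_pow]; norm_num
  rw [e, e] at hd
  simp only [← pow_two] at hd
  exact_mod_cast hd

/-! ### The block step (Amy–Glaudell–Ross, Lemma 5.2) -/

/-- Integer version of the sign pattern of `2 (H⊗H)`. [folklore] -/
def hhSignZ : Fin 4 → Fin 4 → ℤ :=
  ![![1, 1, 1, 1], ![1, -1, 1, -1], ![1, 1, -1, -1], ![1, -1, -1, 1]]

/-- `hhSign` is the cast of `hhSignZ`. [folklore] -/
theorem hhSign_eq_cast (p q : Fin 4) : hhSign p q = (hhSignZ p q : ℚ) := by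
  fin_cases p <;> fin_cases q <;> simp [hhSign, hhSignZ]

/-- **Amy–Glaudell–Ross, Lemma 5.2.** If `y₀ ≡ y₁ ≡ y₂ ≡ y₃ ≡ 1 (mod 4)` then every entry of
`2 (H⊗H) y` is divisible by `4`, i.e. `(H⊗H) y` is an EVEN integer vector.
[cite: AmyGlaudellRoss2020, Lemma 5.2] -/
theorem four_dvd_sum_hhSignZ_mul (y : Fin 4 → ℤ) (hy : ∀ q, y q % 4 = 1) (p : Fin 4) :
    (4 : ℤ) ∣ ∑ q, hhSignZ p q * y q := by
  have h0 := hy 0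
  have h1 := hy 1
  have h2 := hy 2
  have h3 := hy 3
  fin_cases p <;> simp [hhSignZ, Fin.sum_univ_four] <;> omega

/-- The integer vector obtained from `z` by applying the conjugated block `(H⊗H)_[σ0,σ1,σ2,σ3]`
(and clearing the common denominator): the block coordinates `σ q` receive
`(∑_q' ± z (σ q')) / 2`, the others are unchanged. [cite: AmyGlaudellRoss2020, Lemma 5.2] -/
def blockStep (hN : 4 ≤ N) (σ : Equiv.Perm (Fin N)) (z : Fin N → ℤ) : Fin N → ℤ := fun i =>
  if h : (σ.symm i).val < 4 then
    (∑ q, hhSignZ ⟨(σ.symm i).val, h⟩ q * z (σ (Fin.castLE hN q))) / 2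
  else z i

/-- `blockStep` on a block coordinate. [cite: AmyGlaudellRoss2020, Lemma 5.2] -/
theorem blockStep_apply_block (hN : 4 ≤ N) (σ : Equiv.Perm (Fin N)) (z : Fin N → ℤ) (p : Fin 4) :
    blockStep hN σ z (σ (Fin.castLE hN p)) = (∑ q, hhSignZ p q * z (σ (Fin.castLE hN q))) / 2 := by
  simp only [blockStep, Equiv.symm_apply_apply, Fin.val_castLE, Fin.is_lt, dif_pos, Fin.eta]

/-- `blockStep` off the block. [cite: AmyGlaudellRoss2020, Lemma 5.2] -/
theorem blockStep_apply_of_not (hN : 4 ≤ N) {σ : Equiv.Perm (Fin N)} {z : Fin N → ℤ} {i : Fin N}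
    (h : ¬ (σ.symm i).val < 4) : blockStep hN σ z i = z i := by
  simp [blockStep, h]

/-- The conjugated block `P_σ (H⊗H)_[0,1,2,3] P_σ⁻¹` sends `z / 2^k` to `blockStep σ z / 2^k`,
provided the relevant sums are even (so that the integer division is exact).
[cite: AmyGlaudellRoss2020, Lemma 5.2] -/
theorem conj_hadamardBlock_mulVec (hN : 4 ≤ N) (σ : Equiv.Perm (Fin N)) (z : Fin N → ℤ) (k : ℕ)
    (hdiv : ∀ p : Fin 4, (2 : ℤ) ∣ ∑ q, hhSignZ p q * z (σ (Fin.castLE hN q))) :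
    toMat N (permOp σ * hadamardBlock hN * permOp σ⁻¹) *ᵥ (fun i => (z i : ℚ) / 2 ^ k) =
      fun i => (blockStep hN σ z i : ℚ) / 2 ^ k := by
  funext i
  rw [toMat_mul_mulVec, toMat_mul_mulVec, permOp_mulVec]
  by_cases h : (σ.symm i).val < 4
  · obtain ⟨p, hp⟩ : ∃ p : Fin 4, Fin.castLE hN p = σ.symm i := ⟨⟨_, h⟩, Fin.ext rfl⟩
    have hi : i = σ (Fin.castLE hN p) := by rw [hp, Equiv.apply_symm_apply]
    rw [← hp, hadamardBlock_mulVec_castLE, hi, blockStep_apply_block,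
      Int.cast_div (hdiv p) two_ne_zero]
    simp only [permOp_mulVec, Equiv.Perm.inv_def, Equiv.symm_symm, hhSign_eq_cast]
    push_cast
    simp only [Finset.sum_div]
    refine Finset.sum_congr rfl fun q _ => ?_
    ring
  · rw [hadamardBlock_mulVec_of_not_lt hN h, permOp_mulVec, blockStep_apply_of_not hN h,
      Equiv.Perm.inv_def, Equiv.symm_symm, Equiv.apply_symm_apply]

/-! ### Reduction of the least denominator exponent (Amy–Glaudell–Ross, Lemmas 5.3–5.4) -/

/-- **Amy–Glaudell–Ross, Lemma 5.3** (with the sign fixes of Lemma 5.2 done one at a time).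
A vector `z / 2^(k+1)` (`z` integral, `∑ z² = 4^(k+1)`, vanishing below `m`) is carried by an
element of `⟨generators⟩ ∩ Stab(e_0,…,e_{m-1})` to a vector `z' / 2^k` with `z'` integral and
vanishing below `m`.  Induction on `#{odd entries} + #{entries ≡ 3 (mod 4)}`: flip the sign of an
entry `≡ 3 (mod 4)`; otherwise all odd entries are `≡ 1 (mod 4)`, their number is a positive
multiple of `4`, and the block on four of them makes them even; when no entry is odd, halve.
[cite: AmyGlaudellRoss2020, Lemma 5.3] -/
theorem exists_reduce_lde (hN : 4 ≤ N) (m k : ℕ) :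
    ∀ (μ : ℕ) (z : Fin N → ℤ),
      (Finset.univ.filter fun i => Odd (z i)).card +
          (Finset.univ.filter fun i => z i % 4 = 3).card = μ →
      (∑ i, z i ^ 2 = 4 ^ (k + 1)) → (∀ i : Fin N, i.val < m → z i = 0) →
      ∃ g ∈ Subgroup.closure (agrGenerators hN) ⊓ stabLow N m, ∃ z' : Fin N → ℤ,
        (∀ i : Fin N, i.val < m → z' i = 0) ∧
        toMat N g *ᵥ (fun i => (z i : ℚ) / 2 ^ (k + 1)) = fun i => (z' i : ℚ) / 2 ^ k := by
  intro μ
  induction μ using Nat.strong_induction_on with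
  | _ μ ih =>
  intro z hμ hsum hvan
  by_cases hthree : ∃ a, z a % 4 = 3
  · -- flip the sign of an entry `≡ 3 (mod 4)`
    obtain ⟨a, ha⟩ := hthree
    have ha0 : z a ≠ 0 := by omega
    have ham : m ≤ a.val := by
      by_contra h
      exact ha0 (hvan a (by omega))
    set z₁ : Fin N → ℤ := fun i => if i = a then -z i else z i with hz₁
    have hodd : (Finset.univ.filter fun i => Odd (z₁ i)) =
        Finset.univ.filter fun i => Odd (z i) := by
      ext i
      simp only [Finset.mem_filter, Finset.mem_univ, true_and, hz₁]
      split_ifs <;> simp [odd_neg]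
    have hthr : (Finset.univ.filter fun i => z₁ i % 4 = 3) =
        (Finset.univ.filter fun i => z i % 4 = 3).erase a := by
      ext i
      simp only [Finset.mem_filter, Finset.mem_univ, true_and, Finset.mem_erase, hz₁]
      by_cases hia : i = a
      · subst hia
        simp only [if_true, ne_eq, not_true_eq_false, false_and, iff_false]
        omega
      · simp [hia]
    have hlt : (Finset.univ.filter fun i => Odd (z₁ i)).card +
        (Finset.univ.filter fun i => z₁ i % 4 = 3).card < μ := by
      rw [hodd, hthr, ← hμ]
      have := Finset.card_erase_lt_of_mem (s := Finset.univ.filter fun i => z i % 4 = 3) (a := a)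
        (by simp [ha])
      omega
    have hsum₁ : ∑ i, z₁ i ^ 2 = 4 ^ (k + 1) := by
      rw [← hsum]
      refine Finset.sum_congr rfl fun i _ => ?_
      simp only [hz₁]
      split_ifs <;> ring
    have hvan₁ : ∀ i : Fin N, i.val < m → z₁ i = 0 := fun i hi => by
      have : i ≠ a := fun h => by subst h; omega
      simp [hz₁, this, hvan i hi]
    obtain ⟨g, hg, z', hz', hgz⟩ := ih _ hlt z₁ rfl hsum₁ hvan₁
    refine ⟨g * negAt a, Subgroup.mul_mem _ hg
      (Subgroup.mem_inf.2 ⟨negAt_mem_closure hN a, negAt_mem_stabLow ham⟩), z', hz', ?_⟩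
    rw [toMat_mul_mulVec, ← hgz]
    congr 1
    funext j
    rw [negAt_mulVec]
    simp only [hz₁]
    split_ifs <;> push_cast <;> ring
  · push Not at hthree
    by_cases hodd0 : (Finset.univ.filter fun i => Odd (z i)).card = 0
    · -- no odd entry: halve
      have hev : ∀ i, Even (z i) := fun i => by
        have h0 := Finset.card_eq_zero.1 hodd0
        have hi : i ∉ Finset.univ.filter (fun i => Odd (z i)) := by simp [h0]
        simpa [Int.not_odd_iff_even] using hi
      refine ⟨1, Subgroup.one_mem _, fun i => z i / 2, fun i hi => by simp [hvan i hi], ?_⟩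
      rw [map_one, Matrix.one_mulVec]
      funext i
      obtain ⟨t, ht⟩ := hev i
      have hzi : z i = 2 * t := by rw [ht]; ring
      simp only [hzi, Int.mul_ediv_cancel_left _ (two_ne_zero (α := ℤ))]
      push_cast
      rw [pow_succ]
      field_simp
    · -- the block step on four odd entries, all `≡ 1 (mod 4)`
      have h4 : 4 ∣ (Finset.univ.filter fun i => Odd (z i)).card := four_dvd_card_filter_odd hsum
      have hcard : 4 ≤ (Finset.univ.filter fun i => Odd (z i)).card :=
        Nat.le_of_dvd (Nat.pos_of_ne_zero hodd0) h4
      obtain ⟨S, hSO, hS4⟩ := Finset.exists_subset_card_eq hcard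
      set B : Finset (Fin N) := Finset.univ.map (Fin.castLEEmb hN) with hB
      have hB4 : B.card = 4 := by simp [hB]
      obtain ⟨σ, hσ⟩ := Equiv.Perm.exists_map_finset_eq B S (hB4.trans hS4.symm)
      have hmemS : ∀ i, i ∈ S ↔ (σ.symm i).val < 4 := fun i => by
        rw [← hσ, Finset.mem_map_equiv]
        simp only [hB, Finset.mem_map, Finset.mem_univ, true_and]
        constructor
        · rintro ⟨q, hq⟩
          rw [← hq]
          exact q.isLt
        · intro h
          exact ⟨⟨_, h⟩, Fin.ext rfl⟩
      have hσS : ∀ q : Fin 4, σ (Fin.castLE hN q) ∈ S := fun q => by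
        rw [hmemS, Equiv.symm_apply_apply]
        exact q.isLt
      have hσodd : ∀ q, Odd (z (σ (Fin.castLE hN q))) := fun q => by
        simpa using hSO (hσS q)
      have hσ1 : ∀ q, z (σ (Fin.castLE hN q)) % 4 = 1 := fun q => by
        have h1 := hσodd q
        have h2 := hthree (σ (Fin.castLE hN q))
        rw [Int.odd_iff] at h1
        omega
      have hσm : ∀ q : Fin 4, m ≤ (σ (Fin.castLE hN q)).val := fun q => by
        by_contra h
        have h0 := hvan _ (not_le.1 h)
        have h1 := hσ1 q
        rw [h0] at h1
        omega
      have hdiv4 : ∀ p : Fin 4, (4 : ℤ) ∣ ∑ q, hhSignZ p q * z (σ (Fin.castLE hN q)) := fun p =>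
        four_dvd_sum_hhSignZ_mul _ hσ1 p
      have hdiv2 : ∀ p : Fin 4, (2 : ℤ) ∣ ∑ q, hhSignZ p q * z (σ (Fin.castLE hN q)) := fun p =>
        dvd_trans ⟨2, by norm_num⟩ (hdiv4 p)
      set z₂ := blockStep hN σ z with hz₂
      have heven₂ : ∀ p, Even (z₂ (σ (Fin.castLE hN p))) := fun p => by
        rw [hz₂, blockStep_apply_block]
        obtain ⟨c, hc⟩ := hdiv4 p
        rw [hc, show (4 : ℤ) * c / 2 = c + c by omega]
        exact ⟨c, rfl⟩
      have hblock : ∀ i, (σ.symm i).val < 4 → ∃ p : Fin 4, σ (Fin.castLE hN p) = i := fun i hi =>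
        ⟨⟨_, hi⟩, by rw [show Fin.castLE hN ⟨_, hi⟩ = σ.symm i from Fin.ext rfl, Equiv.apply_symm_apply]⟩
      have hodd₂ : (Finset.univ.filter fun i => Odd (z₂ i)) =
          (Finset.univ.filter fun i => Odd (z i)) \ S := by
        ext i
        simp only [Finset.mem_filter, Finset.mem_sdiff, Finset.mem_univ, true_and]
        by_cases hi : (σ.symm i).val < 4
        · obtain ⟨p, rfl⟩ := hblock i hi
          simp only [Int.not_odd_iff_even.2 (heven₂ p), hσS p, not_true_eq_false, and_false]
        · rw [hz₂, blockStep_apply_of_not hN hi]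
          simp [(hmemS i).not.2 hi]
      have hthr₂ : (Finset.univ.filter fun i => z₂ i % 4 = 3) = ∅ := by
        ext i
        simp only [Finset.mem_filter, Finset.mem_univ, true_and, Finset.notMem_empty, iff_false]
        by_cases hi : (σ.symm i).val < 4
        · obtain ⟨p, rfl⟩ := hblock i hi
          obtain ⟨c, hc⟩ := heven₂ p
          rw [hc]
          omega
        · rw [hz₂, blockStep_apply_of_not hN hi]
          exact hthree i
      have hthr0 : (Finset.univ.filter fun i => z i % 4 = 3) = ∅ := by
        ext i
        simp [hthree i]
      have hlt : (Finset.univ.filter fun i => Odd (z₂ i)).card +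
          (Finset.univ.filter fun i => z₂ i % 4 = 3).card < μ := by
        rw [hodd₂, hthr₂, Finset.card_sdiff_of_subset hSO, hS4, ← hμ, hthr0, Finset.card_empty]
        omega
      have hK := conj_hadamardBlock_mulVec hN σ z (k + 1) hdiv2
      have hsum₂ : ∑ i, z₂ i ^ 2 = 4 ^ (k + 1) := by
        have h := sum_sq_mul_eq_of_mulVec_eq _ hK
        rw [hsum] at h
        exact mul_right_cancel₀ (pow_ne_zero _ (by norm_num)) h
      have hvan₂ : ∀ i : Fin N, i.val < m → z₂ i = 0 := fun i hi => by
        have hi4 : ¬ (σ.symm i).val < 4 := fun h => by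
          obtain ⟨p, rfl⟩ := hblock i h
          have := hσm p
          omega
        rw [hz₂, blockStep_apply_of_not hN hi4]
        exact hvan i hi
      obtain ⟨g, hg, z', hz', hgz⟩ := ih _ hlt z₂ rfl hsum₂ hvan₂
      refine ⟨g * (permOp σ * hadamardBlock hN * permOp σ⁻¹), Subgroup.mul_mem _ hg
        (Subgroup.mem_inf.2 ⟨Subgroup.mul_mem _ (Subgroup.mul_mem _ (permOp_mem_closure hN σ)
          (hadamardBlock_mem_closure hN)) (permOp_mem_closure hN σ⁻¹),
          conj_hadamardBlock_mem_stabLow hN hσm⟩), z', hz', ?_⟩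
      rw [toMat_mul_mulVec, hK, hgz]

/-- **Amy–Glaudell–Ross, Lemma 5.4 (column lemma).** A dyadic unit vector `z / 2^k`
(`∑ z² = 4^k`) vanishing below `m < N` is carried to `e_m` by an element of the group generated by
the generators which fixes `e_0, …, e_{m-1}`.  Induction on `k`; `k = 0`: `z = ± e_{i₀}`, use a
transposition and a sign change. [cite: AmyGlaudellRoss2020, Lemma 5.4] -/
theorem exists_mem_mulVec_eq_single (hN : 4 ≤ N) {m : ℕ} (hm : m < N) :
    ∀ (k : ℕ) (z : Fin N → ℤ), (∑ i, z i ^ 2 = 4 ^ k) → (∀ i : Fin N, i.val < m → z i = 0) →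
      ∃ g ∈ Subgroup.closure (agrGenerators hN) ⊓ stabLow N m,
        toMat N g *ᵥ (fun i => (z i : ℚ) / 2 ^ k) = Pi.single ⟨m, hm⟩ 1 := by
  intro k
  induction k with
  | zero =>
    intro z hsum hvan
    rw [pow_zero] at hsum
    obtain ⟨i₀, hsign, hrest⟩ := exists_eq_single_of_sum_sq_eq_one hsum
    have hi₀m : m ≤ i₀.val := by
      by_contra h
      have := hvan i₀ (by omega)
      rcases hsign with h1 | h1 <;> omega
    set a : Fin N := ⟨m, hm⟩ with ha
    have hswap_stab : permOp (Equiv.swap a i₀) ∈ stabLow N m := permOp_mem_stabLow fun j hj =>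
      Equiv.swap_apply_of_ne_of_ne (fun h => by subst h; simp [ha] at hj)
        (fun h => by subst h; omega)
    have hPu : toMat N (permOp (Equiv.swap a i₀)) *ᵥ (fun i => (z i : ℚ) / 2 ^ 0) =
        fun i => if i = a then (z i₀ : ℚ) else 0 := by
      funext l
      rw [permOp_mulVec, Equiv.symm_swap, pow_zero, div_one]
      by_cases hl : l = a
      · subst hl
        simp
      · rw [if_neg hl]
        by_cases hli : l = i₀
        · subst hli
          rw [Equiv.swap_apply_right]
          exact_mod_cast hrest a (Ne.symm hl)
        · rw [Equiv.swap_apply_of_ne_of_ne hl hli]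
          exact_mod_cast hrest l hli
    rcases hsign with h1 | h1
    · refine ⟨permOp (Equiv.swap a i₀),
        Subgroup.mem_inf.2 ⟨permOp_mem_closure hN _, hswap_stab⟩, ?_⟩
      rw [hPu]
      funext l
      simp [Pi.single_apply, h1]
    · refine ⟨negAt a * permOp (Equiv.swap a i₀), Subgroup.mem_inf.2
        ⟨Subgroup.mul_mem _ (negAt_mem_closure hN a) (permOp_mem_closure hN _),
          Subgroup.mul_mem _ (negAt_mem_stabLow le_rfl) hswap_stab⟩, ?_⟩
      rw [toMat_mul_mulVec, hPu]
      funext l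
      rw [negAt_mulVec]
      by_cases hl : l = a
      · subst hl
        simp [h1]
      · simp [hl]
  | succ k ih =>
    intro z hsum hvan
    obtain ⟨g₁, hg₁, z', hz'van, hg₁z⟩ := exists_reduce_lde hN m k _ z rfl hsum hvan
    have hsum' : ∑ i, z' i ^ 2 = 4 ^ k := by
      have h := sum_sq_mul_eq_of_mulVec_eq g₁ hg₁z
      have h' : (∑ i, z' i ^ 2) * 4 ^ (k + 1) = 4 ^ k * 4 ^ (k + 1) := by rw [h, hsum]; ring
      exact mul_right_cancel₀ (pow_ne_zero _ (by norm_num)) h'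
    obtain ⟨g₂, hg₂, hg₂z⟩ := ih z' hsum' hz'van
    exact ⟨g₂ * g₁, Subgroup.mul_mem _ hg₂ hg₁, by rw [toMat_mul_mulVec, hg₁z, hg₂z]⟩

/-- **Amy–Glaudell–Ross, Theorem 5.5 (exact synthesis over `ℤ[1/2]`).** For `N ≥ 4` the group
`Γ_N = O_N(ℤ[1/2])` is generated by the one-level sign changes `(−1)_[a]`, the permutation
matrices, and the single four-level block `(H⊗H)_[0,1,2,3]` (whose conjugates by permutation
matrices are all the `(H⊗H)_[a,b,c,d]`).  Proof: reduce the columns of `M ∈ Γ_N` to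
`e_0, e_1, …` one at a time by the column lemma. [cite: AmyGlaudellRoss2020, Theorem 5.5] -/
theorem closure_agrGenerators_eq_top (hN : 4 ≤ N) : Subgroup.closure (agrGenerators hN) = ⊤ := by
  rw [eq_top_iff]
  intro M _
  have key : ∀ m, m ≤ N → ∃ g ∈ Subgroup.closure (agrGenerators hN),
      ∀ j : Fin N, j.val < m → toMat N (g * M) *ᵥ Pi.single j 1 = Pi.single j 1 := by
    intro m
    induction m with
    | zero => exact fun _ => ⟨1, Subgroup.one_mem _, fun j hj => absurd hj (Nat.not_lt_zero _)⟩
    | succ m ih =>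
      intro hm
      obtain ⟨g, hg, hfix⟩ := ih (Nat.le_of_succ_le hm)
      have hmN : m < N := hm
      set u := toMat N (g * M) *ᵥ Pi.single (⟨m, hmN⟩ : Fin N) 1 with hu
      have hud : ∀ i, u i ∈ dyadicRationals := fun i => by
        rw [hu, Matrix.mulVec_single_one]
        exact toMat_mem_dyadicRationals (g * M) i ⟨m, hmN⟩
      obtain ⟨k, z, hz⟩ := exists_eq_intCast_div_two_pow u hud
      have hsum : ∑ i, z i ^ 2 = 4 ^ k := by
        have h1 : u ⬝ᵥ u = 1 := by
          rw [hu, dotProduct_toMat_mulVec]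
          simp
        rw [hz] at h1
        simp only [dotProduct, div_mul_div_comm, ← Finset.sum_div] at h1
        rw [div_eq_one_iff_eq (mul_ne_zero (pow_ne_zero _ two_ne_zero) (pow_ne_zero _ two_ne_zero)),
          ← mul_pow, show (2 : ℚ) * 2 = 4 by norm_num] at h1
        simp only [← pow_two] at h1
        exact_mod_cast h1
      have hvan : ∀ i : Fin N, i.val < m → z i = 0 := fun i hi => by
        have h1 : u ⬝ᵥ Pi.single i 1 = 0 := by
          rw [hu]
          conv_lhs => rw [← hfix i hi]
          rw [dotProduct_toMat_mulVec, dotProduct_single, mul_one, Pi.single_apply, if_neg]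
          exact fun h => by rw [Fin.ext_iff] at h; simp at h; omega
        rw [dotProduct_single, mul_one, hz] at h1
        simpa using h1
      obtain ⟨g', hg', hg'u⟩ := exists_mem_mulVec_eq_single hN hmN k z hsum hvan
      rw [← hz] at hg'u
      refine ⟨g' * g, Subgroup.mul_mem _ (Subgroup.mem_inf.1 hg').1 hg, fun j hj => ?_⟩
      rw [mul_assoc, toMat_mul_mulVec]
      rcases Nat.lt_succ_iff_lt_or_eq.1 hj with hj | hj
      · rw [hfix j hj]
        exact (Subgroup.mem_inf.1 hg').2 j hj
      · obtain rfl : j = ⟨m, hmN⟩ := Fin.ext hj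
        exact hg'u
  obtain ⟨g, hg, hfix⟩ := key N le_rfl
  have hgM : g * M = 1 := by
    apply toMat_injective
    rw [map_one]
    exact Matrix.ext_of_mulVec_single fun j => by rw [hfix j j.isLt, Matrix.one_mulVec]
  rw [eq_inv_of_mul_eq_one_right hgM]
  exact Subgroup.inv_mem _ hg

end Synthesis

end Literature.Barriers.QuantumAdvantage

end
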